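import Literature.Probability.LatticeModels.LatticeGreenHeatKernel
import Mathlib.Analysis.Calculus.ParametricIntervalIntegral
import Mathlib.Analysis.SpecialFunctions.Pow.Deriv
import Mathlib.Analysis.SpecialFunctions.Pow.Asymptotics
import HarnessLib

/-!
# The lattice Green function at the origin is at most `1/(d-2)` (Salmhofer–Seiler 1991, Lemma A.4)

Topic `Probability/LatticeModels`, namespace `Literature.Probability.LatticeModels`; companion of
`LatticeGreenFunction.lean` (`latticeGreen z = ∫_{[-π,π]^d} cos(p·z)/ε(p) dp/(2π)^d`,
`ε(p) = Σᵢ(1 - cos pᵢ)`), `SRWHeatKernel1D.lean` (`srwHeatKernel t m = q_t(m) =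
(1/2π)∫_{-π}^{π} cos(km)e^{-t(1-cos k)}dk = e^{-t}I_m(t)`) and `LatticeGreenHeatKernel.lean`
(`latticeGreen x = ∫₀^∞ ∏ᵢ q_t(xᵢ) dt` for `d ≥ 3`).  The quantity `R(ν) = latticeGreen 0`
(`= ∫ d^νk/(2π)^ν D(k)⁻¹`, `D = Σ_μ(1 - cos k_μ)`) is the constant of the infrared-bound proofs of
long-range order (Fröhlich–Simon–Spencer 1976) and the `R(ν)` of the Appendix of

* M. Salmhofer, E. Seiler, *Proof of chiral symmetry breaking in strongly coupled lattice gauge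
  theory*, Commun. Math. Phys. **139** (1991) 395–432, Appendix, (A.4), (A.7), Lemma A.4 with
  (A.22)–(A.27), p. 425 and p. 427 [SalmhoferSeiler1991],

whose Lemma A.4 is PROVED here, following the printed proof line by line:

* `srwHeatKernel_zero_eq` — (A.24): `r(x) := q_x(0) = (1/2π)∫_{-π}^{π} e^{x(cos t - 1)} dt`
  (`= I₀(x)e^{-x}`);
* `integral_heatExp_ode` — the differential equation (A.26) `x r'' + (1 + 2x) r' + r = 0`, in the
  integrated form `x C(x) - (1 + 2x) B(x) + A(x) = 0` for the three moment integrals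
  `A = ∫e^{x(cos t-1)}`, `B = ∫(1 - cos t)e^{x(cos t-1)}` (`= -2π r'`), `C = ∫(1 - cos t)²e^{x(cos t-1)}`
  (`= 2π r'' ≥ 0`, (A.25)): the integrand of the combination is `(cos t - x sin²t)e^{x(cos t - 1)} =
  d/dt[sin t · e^{x(cos t-1)}]`, which integrates to zero over a period (this is how the Bessel
  equation (A.19) for `I₀` is proved from the integral representation; we do not go through `I₀`);
* `hasDerivAt_integral_heatExp` — `A' = -B` (differentiation under the integral sign);
* `antitoneOn_one_add_two_mul_mul_sq` — (A.27) "`(1 + 2x) r' + r ≤ 0` for `x ≥ 0`, which upon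
  integration gives (A.22)": `d/dx[(1 + 2x)A(x)²] = 2A(A - (1+2x)B) = -2xAC ≤ 0`, so
  `(1 + 2x)A(x)²` is non-increasing on `[0, ∞)`;
* **`srwHeatKernel_zero_le_inv_sqrt`** — (A.22): `0 ≤ r(x) ≤ (1 + 2x)^{-1/2}` for `x ≥ 0`
  ("the upper bound becomes exact as `x → 0`": `r(0) = 1`);
* **`latticeGreen_zero_le_inv_sub_two`** — (A.23): `R(d) = latticeGreen 0 ≤ 1/(d - 2)` for
  `d ≥ 3`, from (A.7) (`latticeGreen_eq_integral_prod_srwHeatKernel`) and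
  `∫₀^∞ (1 + 2x)^{-d/2} dx = 1/(d - 2)`.

Everything is proved; no definition and no named fact is introduced.  (The tree's
`srwHeatKernel_zero_le_rpow` of `FitznerVanDerHofstad2017/SrwTwistTruncationSeeds` is the cruder
`q_t(0) ≤ (1 ∨ t)^{-1/2}`; the Summit-side `latticeGreen_zero_le` is the numerical `d = 3` bound
`13/25`.  Neither gives (A.23).)  Used downstream for Salmhofer–Seiler's Prop. 4.2(2),
`S(ν) ≤ νR(ν) - 3/4 ≤ ν/(ν-2) - 3/4` (`ComplexSpinFluctuationBound.lean`).

## References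

* M. Salmhofer, E. Seiler, Commun. Math. Phys. 139 (1991) 395–432, Appendix (A.4), (A.7),
  Lemma A.4, (A.22)–(A.27). [SalmhoferSeiler1991]
* J. Fröhlich, B. Simon, T. Spencer, Commun. Math. Phys. 50 (1976) 79–95 (the constant of the
  infrared bound; Salmhofer–Seiler's [18]). [FrohlichSimonSpencer1976]

## Mathlib

`intervalIntegral.hasDerivAt_integral_of_dominated_loc_of_deriv_le` (differentiation under the
integral sign), `intervalIntegral.integral_eq_sub_of_hasDerivAt` (periodic boundary term),
`antitoneOn_of_hasDerivWithinAt_nonpos`, `MeasureTheory.integral_Ioi_of_hasDerivAt_of_nonneg'`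
and `integrableOn_Ioi_deriv_of_nonneg'` (the majorant `∫₀^∞(1+2x)^{-d/2}dx`), `HasDerivAt.rpow_const`,
`tendsto_rpow_neg_atTop`.
-/

noncomputable section

open MeasureTheory Set Filter Real
open scoped Topology

namespace Literature.Probability.LatticeModels

variable {d : ℕ}

/-! ### (A.24): the heat kernel at the origin -/

/-- (A.24): `r(x) = q_x(0) = (1/2π) ∫_{-π}^{π} e^{x(cos t - 1)} dt` (`= I₀(x) e^{-x}`).
[cite: SalmhoferSeiler1991, Appendix (A.24)] -/
theorem srwHeatKernel_zero_eq (t : ℝ) :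
    srwHeatKernel t 0 = (∫ k in (-π)..π, Real.exp (-(t * (1 - Real.cos k)))) / (2 * π) := by
  unfold srwHeatKernel
  simp only [Int.cast_zero, mul_zero, Real.cos_zero, one_mul]

/-- The three moment integrands are continuous (used for interval integrability). [folklore] -/
private theorem continuous_heatExp (t : ℝ) (n : ℕ) :
    Continuous fun k : ℝ => (1 - Real.cos k) ^ n * Real.exp (-(t * (1 - Real.cos k))) := by
  fun_prop

/-- `A(x) = ∫_{-π}^{π} e^{x(cos t - 1)} dt ≥ 0` (`= 2π r(x)`, the printed `0 ≤ r(x)` of (A.22)).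
[cite: SalmhoferSeiler1991, Lemma A.4 (1), (A.22)] -/
theorem integral_heatExp_nonneg (t : ℝ) :
    0 ≤ ∫ k in (-π)..π, Real.exp (-(t * (1 - Real.cos k))) :=
  intervalIntegral.integral_nonneg (by linarith [Real.pi_pos]) fun k _ => (Real.exp_pos _).le

/-- `C(x) = ∫_{-π}^{π} (1 - cos t)² e^{x(cos t - 1)} dt ≥ 0` — this is `2π r''(x) ≥ 0`, (A.25).
[cite: SalmhoferSeiler1991, Appendix (A.25)] -/
theorem integral_sq_mul_heatExp_nonneg (t : ℝ) :
    0 ≤ ∫ k in (-π)..π, (1 - Real.cos k) ^ 2 * Real.exp (-(t * (1 - Real.cos k))) :=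
  intervalIntegral.integral_nonneg (by linarith [Real.pi_pos]) fun k _ =>
    mul_nonneg (sq_nonneg _) (Real.exp_pos _).le

/-- `A(0) = 2π` ("the upper bound becomes exact as `x → 0`": `r(0) = 1`).
[cite: SalmhoferSeiler1991, Lemma A.4 (1)] -/
theorem integral_heatExp_zero :
    ∫ k in (-π)..π, Real.exp (-((0 : ℝ) * (1 - Real.cos k))) = 2 * π := by
  simp only [zero_mul, neg_zero, Real.exp_zero, intervalIntegral.integral_const, smul_eq_mul,
    mul_one]
  ring

/-! ### (A.26): the differential equation, in integrated form -/

/-- **The differential equation (A.26)** `x r'' + (1 + 2x) r' + r = 0` for `r = I₀e^{-x}`, written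
for the moment integrals `A = ∫e^{x(cos t - 1)}` (`= 2πr`), `B = ∫(1 - cos t)e^{x(cos t-1)}`
(`= -2πr'`), `C = ∫(1 - cos t)²e^{x(cos t-1)}` (`= 2πr''`): `x C - (1 + 2x) B + A = 0`.  Proof: the
combined integrand is `(cos t - x sin²t) e^{x(cos t - 1)} = (d/dt)[sin t · e^{x(cos t - 1)}]`, whose
integral over the period `[-π, π]` vanishes. [cite: SalmhoferSeiler1991, Appendix (A.26) with (A.19), (A.24)] -/
theorem integral_heatExp_ode (t : ℝ) :
    t * (∫ k in (-π)..π, (1 - Real.cos k) ^ 2 * Real.exp (-(t * (1 - Real.cos k))))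
      - (1 + 2 * t) * (∫ k in (-π)..π, (1 - Real.cos k) * Real.exp (-(t * (1 - Real.cos k))))
      + (∫ k in (-π)..π, Real.exp (-(t * (1 - Real.cos k)))) = 0 := by
  have hC : IntervalIntegrable
      (fun k => (1 - Real.cos k) ^ 2 * Real.exp (-(t * (1 - Real.cos k)))) volume (-π) π :=
    (continuous_heatExp t 2).intervalIntegrable _ _
  have hB : IntervalIntegrable
      (fun k => (1 - Real.cos k) * Real.exp (-(t * (1 - Real.cos k)))) volume (-π) π := by
    simpa only [pow_one] using (continuous_heatExp t 1).intervalIntegrable (-π) π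
  have hA : IntervalIntegrable (fun k => Real.exp (-(t * (1 - Real.cos k)))) volume (-π) π := by
    simpa only [pow_zero, one_mul] using (continuous_heatExp t 0).intervalIntegrable (-π) π
  rw [← intervalIntegral.integral_const_mul, ← intervalIntegral.integral_const_mul,
    ← intervalIntegral.integral_sub (hC.const_mul t) (hB.const_mul (1 + 2 * t)),
    ← intervalIntegral.integral_add ((hC.const_mul t).sub (hB.const_mul (1 + 2 * t))) hA]
  -- the combined integrand is the derivative of `sin k · e^{-t(1 - cos k)}`
  have hderiv : ∀ k ∈ uIcc (-π) π,
      HasDerivAt (fun k => Real.sin k * Real.exp (-(t * (1 - Real.cos k))))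
        (t * ((1 - Real.cos k) ^ 2 * Real.exp (-(t * (1 - Real.cos k))))
          - (1 + 2 * t) * ((1 - Real.cos k) * Real.exp (-(t * (1 - Real.cos k))))
          + Real.exp (-(t * (1 - Real.cos k)))) k := by
    intro k _
    have h1 : HasDerivAt (fun k => -(t * (1 - Real.cos k))) (-(t * -(-Real.sin k))) k :=
      (((Real.hasDerivAt_cos k).const_sub 1).const_mul t).neg
    have h := (Real.hasDerivAt_sin k).fun_mul h1.exp
    refine h.congr_deriv ?_
    linear_combination (-(t * Real.exp (-(t * (1 - Real.cos k))))) * Real.sin_sq_add_cos_sq k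
  have hint : IntervalIntegrable (fun k =>
      t * ((1 - Real.cos k) ^ 2 * Real.exp (-(t * (1 - Real.cos k))))
        - (1 + 2 * t) * ((1 - Real.cos k) * Real.exp (-(t * (1 - Real.cos k))))
        + Real.exp (-(t * (1 - Real.cos k)))) volume (-π) π :=
    ((hC.const_mul t).sub (hB.const_mul (1 + 2 * t))).add hA
  rw [intervalIntegral.integral_eq_sub_of_hasDerivAt hderiv hint]
  simp [Real.sin_pi]

/-! ### `A' = -B`: differentiation under the integral sign -/

/-- `(d/dx) ∫_{-π}^{π} e^{x(cos t - 1)} dt = -∫_{-π}^{π} (1 - cos t) e^{x(cos t - 1)} dt`, i.e.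
`2π r'(x) = -B(x)` (the integrand and its `x`-derivative are bounded on `[-π,π]`, locally uniformly
in `x`) — the derivative `r'` entering (A.26)–(A.27), computed from the integral representation
(A.24). [cite: SalmhoferSeiler1991, Appendix (A.24)–(A.27)] -/
theorem hasDerivAt_integral_heatExp (t₀ : ℝ) :
    HasDerivAt (fun t : ℝ => ∫ k in (-π)..π, Real.exp (-(t * (1 - Real.cos k))))
      (∫ k in (-π)..π, -(1 - Real.cos k) * Real.exp (-(t₀ * (1 - Real.cos k)))) t₀ := by
  have h := intervalIntegral.hasDerivAt_integral_of_dominated_loc_of_deriv_le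
    (𝕜 := ℝ) (μ := volume) (a := -π) (b := π)
    (F := fun t k => Real.exp (-(t * (1 - Real.cos k))))
    (F' := fun t k => -(1 - Real.cos k) * Real.exp (-(t * (1 - Real.cos k))))
    (x₀ := t₀) (s := Metric.ball t₀ 1) (bound := fun _ => 2 * Real.exp (2 * (|t₀| + 1)))
    (Metric.ball_mem_nhds t₀ one_pos) ?_ ?_ ?_ ?_ ?_ ?_
  · exact h.2
  · exact Eventually.of_forall fun t =>
      (by fun_prop : Continuous fun k : ℝ => Real.exp (-(t * (1 - Real.cos k)))).aestronglyMeasurable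
  · exact (by fun_prop : Continuous fun k : ℝ =>
      Real.exp (-(t₀ * (1 - Real.cos k)))).intervalIntegrable _ _
  · exact (by fun_prop : Continuous fun k : ℝ =>
      -(1 - Real.cos k) * Real.exp (-(t₀ * (1 - Real.cos k)))).aestronglyMeasurable
  · refine Eventually.of_forall fun k _ t ht => ?_
    have hc0 : 0 ≤ 1 - Real.cos k := sub_nonneg.2 (Real.cos_le_one k)
    have hc2 : 1 - Real.cos k ≤ 2 := by linarith [Real.neg_one_le_cos k]
    have ht' : |t| ≤ |t₀| + 1 := by
      have hd : |t - t₀| < 1 := by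
        have := Metric.mem_ball.1 ht
        rwa [Real.dist_eq] at this
      calc |t| = |t₀ + (t - t₀)| := by ring_nf
        _ ≤ |t₀| + |t - t₀| := abs_add_le _ _
        _ ≤ |t₀| + 1 := by linarith
    have h2 : Real.exp (-(t * (1 - Real.cos k))) ≤ Real.exp (2 * (|t₀| + 1)) := by
      apply Real.exp_le_exp.2
      calc -(t * (1 - Real.cos k)) ≤ |t| * (1 - Real.cos k) := by
            have := neg_abs_le t
            nlinarith
        _ ≤ (|t₀| + 1) * 2 := mul_le_mul ht' hc2 hc0 (by positivity)
        _ = 2 * (|t₀| + 1) := by ring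
    rw [Real.norm_eq_abs, abs_mul, Real.abs_exp, abs_neg, abs_of_nonneg hc0]
    exact mul_le_mul hc2 h2 (Real.exp_pos _).le (by norm_num)
  · exact intervalIntegrable_const
  · refine Eventually.of_forall fun k _ t _ => ?_
    have h0 : HasDerivAt (fun y : ℝ => -(y * (1 - Real.cos k))) (-(1 * (1 - Real.cos k))) t :=
      ((hasDerivAt_id' t).mul_const (1 - Real.cos k)).neg
    exact h0.exp.congr_deriv (by ring)

/-! ### (A.27) integrated: `(1 + 2x) A(x)²` is non-increasing on `[0, ∞)` -/

/-- **(A.27), integrated.**  Since `x r'' ≥ 0` for `x ≥ 0`, the ODE (A.26) gives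
`(1 + 2x) r' + r ≤ 0`, "which, upon integration, gives (A.22)": concretely
`(d/dx)[(1 + 2x) A(x)²] = 2A(A - (1 + 2x)B) = -2x A C ≤ 0` on `(0, ∞)`, so
`x ↦ (1 + 2x) A(x)²` is antitone on `[0, ∞)` (`A = ∫_{-π}^{π} e^{x(cos t - 1)} dt = 2π r(x)`).
[cite: SalmhoferSeiler1991, Appendix (A.26)–(A.27)] -/
theorem antitoneOn_one_add_two_mul_mul_sq :
    AntitoneOn (fun t : ℝ =>
      (1 + 2 * t) * (∫ k in (-π)..π, Real.exp (-(t * (1 - Real.cos k)))) ^ 2) (Ici 0) := by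
  set A : ℝ → ℝ := fun t => ∫ k in (-π)..π, Real.exp (-(t * (1 - Real.cos k))) with hA
  set B : ℝ → ℝ := fun t => ∫ k in (-π)..π, (1 - Real.cos k) * Real.exp (-(t * (1 - Real.cos k)))
    with hB
  set C : ℝ → ℝ := fun t =>
    ∫ k in (-π)..π, (1 - Real.cos k) ^ 2 * Real.exp (-(t * (1 - Real.cos k))) with hC
  -- `A' = -B`
  have hA' : ∀ t, HasDerivAt A (-B t) t := by
    intro t
    have h := hasDerivAt_integral_heatExp t
    have hneg : (∫ k in (-π)..π, -(1 - Real.cos k) * Real.exp (-(t * (1 - Real.cos k)))) = -B t := by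
      simp only [hB, neg_mul, intervalIntegral.integral_neg]
    rw [hneg] at h
    exact h
  -- the derivative of `(1 + 2t) A²`
  have hderiv : ∀ t, HasDerivAt (fun t : ℝ => (1 + 2 * t) * A t ^ 2)
      (2 * A t ^ 2 + (1 + 2 * t) * (2 * A t * (-B t))) t := by
    intro t
    have h1 : HasDerivAt (fun t : ℝ => 1 + 2 * t) 2 t := by
      simpa using ((hasDerivAt_id t).const_mul (2 : ℝ)).const_add 1
    have h2 : HasDerivAt (fun t => A t ^ 2) (2 * A t * (-B t)) t :=
      ((hA' t).fun_pow 2).congr_deriv (by simp only [Nat.cast_ofNat]; ring)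
    exact (h1.fun_mul h2).congr_deriv (by ring)
  refine antitoneOn_of_hasDerivWithinAt_nonpos (convex_Ici 0)
    (fun t _ => (hderiv t).continuousAt.continuousWithinAt)
    (fun t _ => (hderiv t).hasDerivWithinAt) fun t ht => ?_
  rw [interior_Ici] at ht
  have ht0 : 0 ≤ t := le_of_lt ht
  -- `2A² - 2(1+2t)AB = 2A(A - (1+2t)B) = -2tAC`
  have hode : t * C t - (1 + 2 * t) * B t + A t = 0 := integral_heatExp_ode t
  have hApos : 0 ≤ A t := integral_heatExp_nonneg t
  have hCpos : 0 ≤ C t := integral_sq_mul_heatExp_nonneg t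
  have : 2 * A t ^ 2 + (1 + 2 * t) * (2 * A t * -B t) = -(2 * t * (A t * C t)) := by
    linear_combination (2 * A t) * hode
  rw [this, neg_nonpos]
  positivity

/-! ### (A.22): `r(x) ≤ (1 + 2x)^{-1/2}` -/

/-- `r(x) = q_x(0) ≥ 0` (the lower bound in (A.22); here for every real `x`).
[cite: SalmhoferSeiler1991, Lemma A.4 (1), (A.22)] -/
theorem srwHeatKernel_zero_nonneg (t : ℝ) : 0 ≤ srwHeatKernel t 0 := by
  rw [srwHeatKernel_zero_eq]
  exact div_nonneg (integral_heatExp_nonneg t) (by positivity)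

/-- **Lemma A.4 (1), (A.22)**: `0 ≤ r(x) ≤ 1/√(1 + 2x)` for all `x ≥ 0`, where
`r(x) = I₀(x)e^{-x} = q_x(0)` is the heat kernel of the continuous-time simple random walk on `ℤ` at
the origin; "the upper bound becomes exact as `x → 0`". [cite: SalmhoferSeiler1991, Lemma A.4 (1), (A.22)] -/
theorem srwHeatKernel_zero_le_inv_sqrt {t : ℝ} (ht : 0 ≤ t) :
    srwHeatKernel t 0 ≤ 1 / Real.sqrt (1 + 2 * t) := by
  set A : ℝ := ∫ k in (-π)..π, Real.exp (-(t * (1 - Real.cos k))) with hA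
  have hmono := antitoneOn_one_add_two_mul_mul_sq (self_mem_Ici (a := (0 : ℝ))) (mem_Ici.2 ht) ht
  simp only [integral_heatExp_zero, mul_zero, add_zero, one_mul] at hmono
  -- `hmono : (1 + 2t) A² ≤ (2π)²`
  have hApos : 0 ≤ A := integral_heatExp_nonneg t
  have hs : 0 < Real.sqrt (1 + 2 * t) := Real.sqrt_pos.2 (by linarith)
  rw [srwHeatKernel_zero_eq, div_le_div_iff₀ (by positivity) hs, one_mul]
  -- `A √(1+2t) ≤ 2π`
  have h1 : (A * Real.sqrt (1 + 2 * t)) ^ 2 ≤ (2 * π) ^ 2 := by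
    rw [mul_pow, Real.sq_sqrt (by linarith)]
    linarith
  exact (pow_le_pow_iff_left₀ (by positivity) (by positivity) two_ne_zero).1 h1

/-- (A.22) in power form: `q_t(0)^d ≤ (1 + 2t)^{-d/2}` for `t ≥ 0`. [cite: SalmhoferSeiler1991, Lemma A.4, (A.22)] -/
theorem srwHeatKernel_zero_pow_le_rpow {t : ℝ} (ht : 0 ≤ t) (n : ℕ) :
    srwHeatKernel t 0 ^ n ≤ (1 + 2 * t) ^ (-(n : ℝ) / 2) := by
  have h1 := srwHeatKernel_zero_le_inv_sqrt ht
  have hbase : 0 < 1 + 2 * t := by linarith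
  have hsq : 1 / Real.sqrt (1 + 2 * t) = (1 + 2 * t) ^ (-(1 / 2 : ℝ)) := by
    rw [Real.sqrt_eq_rpow, Real.rpow_neg hbase.le, one_div]
  rw [hsq] at h1
  calc srwHeatKernel t 0 ^ n ≤ ((1 + 2 * t) ^ (-(1 / 2 : ℝ))) ^ n :=
        pow_le_pow_left₀ (srwHeatKernel_zero_nonneg t) h1 n
    _ = (1 + 2 * t) ^ (-(n : ℝ) / 2) := by
        rw [← Real.rpow_natCast, ← Real.rpow_mul hbase.le]
        congr 1
        ring

/-! ### (A.23): `R(d) ≤ 1/(d - 2)` -/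

/-- The majorant integral: `∫₀^∞ (1 + 2x)^{-d/2} dx = 1/(d - 2)` for `d ≥ 3`, with integrability
(the primitive `-(1 + 2x)^{-(d-2)/2}/(d - 2)` tends to `0`); calculus plumbing for (A.23). [folklore] -/
private theorem integral_Ioi_one_add_two_mul_rpow (hd : 3 ≤ d) :
    IntegrableOn (fun t : ℝ => (1 + 2 * t) ^ (-(d : ℝ) / 2)) (Ioi 0) ∧
      ∫ t in Ioi (0 : ℝ), (1 + 2 * t) ^ (-(d : ℝ) / 2) = 1 / ((d : ℝ) - 2) := by
  have hd' : (3 : ℝ) ≤ d := by exact_mod_cast hd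
  have hd2 : 0 < (d : ℝ) - 2 := by linarith
  set p : ℝ := -((d : ℝ) - 2) / 2 with hp
  have hp_neg : p < 0 := by rw [hp]; linarith
  set G : ℝ → ℝ := fun t => -((1 + 2 * t) ^ p) / ((d : ℝ) - 2) with hG
  -- `G' = (1 + 2t)^{-d/2}` on `[0, ∞)`
  have hderiv : ∀ t ∈ Ici (0 : ℝ), HasDerivAt G ((1 + 2 * t) ^ (-(d : ℝ) / 2)) t := by
    intro t ht
    have hbase : 0 < 1 + 2 * t := by linarith [mem_Ici.1 ht]
    have h1 : HasDerivAt (fun t : ℝ => 1 + 2 * t) 2 t := by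
      simpa using ((hasDerivAt_id t).const_mul (2 : ℝ)).const_add 1
    have h2 : HasDerivAt (fun t : ℝ => (1 + 2 * t) ^ p) (2 * p * (1 + 2 * t) ^ (p - 1)) t :=
      h1.rpow_const (Or.inl hbase.ne')
    have h3 := (h2.neg).div_const ((d : ℝ) - 2)
    refine h3.congr_deriv ?_
    have hexp : p - 1 = -(d : ℝ) / 2 := by rw [hp]; ring
    rw [hexp, hp]
    field_simp
  have hpos : ∀ t ∈ Ioi (0 : ℝ), 0 ≤ (1 + 2 * t) ^ (-(d : ℝ) / 2) := fun t ht =>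
    Real.rpow_nonneg (by linarith [mem_Ioi.1 ht]) _
  -- `G → 0` at `∞`
  have hlim : Tendsto G atTop (𝓝 0) := by
    have h1 : Tendsto (fun t : ℝ => 1 + 2 * t) atTop atTop :=
      tendsto_atTop_add_const_left _ _ (tendsto_id.const_mul_atTop (by norm_num : (0 : ℝ) < 2))
    have h2 : Tendsto (fun t : ℝ => (1 + 2 * t) ^ p) atTop (𝓝 0) := by
      have h3 := (tendsto_rpow_neg_atTop (y := ((d : ℝ) - 2) / 2) (by linarith)).comp h1
      have hp' : -(((d : ℝ) - 2) / 2) = p := by rw [hp]; ring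
      rw [hp'] at h3
      exact h3
    have h4 := (h2.neg).div_const ((d : ℝ) - 2)
    simpa using h4
  refine ⟨integrableOn_Ioi_deriv_of_nonneg' hderiv hpos hlim, ?_⟩
  rw [integral_Ioi_of_hasDerivAt_of_nonneg' hderiv hpos hlim]
  simp only [hG, mul_zero, add_zero, Real.one_rpow, zero_sub]
  ring

/-- **Lemma A.4 (2), (A.23): `R(d) ≤ 1/(d - 2)` for `d ≥ 3`**, where
`R(d) = latticeGreen 0 = ∫_{[-π,π]^d} d^dk/((2π)^d D(k))`, `D(k) = Σ_μ (1 - cos k_μ)`, is the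
lattice Green function of `ℤ^d` at the origin (Salmhofer–Seiler's (A.4); the constant of the
Fröhlich–Simon–Spencer infrared bound).  Proof as printed: (A.7) `R(d) = ∫₀^∞ r(x)^d dx` (the tree's
`latticeGreen_eq_integral_prod_srwHeatKernel`) and (A.22) `r(x) ≤ (1 + 2x)^{-1/2}`, so
`R(d) ≤ ∫₀^∞ (1 + 2x)^{-d/2} dx = 1/(d - 2)`. [cite: SalmhoferSeiler1991, Lemma A.4 (2), (A.23)] -/
theorem latticeGreen_zero_le_inv_sub_two (hd : 3 ≤ d) :
    latticeGreen (0 : Site d) ≤ 1 / ((d : ℝ) - 2) := by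
  obtain ⟨hint, heq⟩ := latticeGreen_eq_integral_prod_srwHeatKernel hd 0
  obtain ⟨hmaj, hval⟩ := integral_Ioi_one_add_two_mul_rpow hd
  rw [heq, ← hval]
  refine setIntegral_mono_on hint hmaj measurableSet_Ioi fun t ht => ?_
  have ht0 : 0 ≤ t := le_of_lt (mem_Ioi.1 ht)
  simp only [Pi.zero_apply, Finset.prod_const, Finset.card_univ, Fintype.card_fin]
  exact srwHeatKernel_zero_pow_le_rpow ht0 d

end Literature.Probability.LatticeModels

end
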